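import Literature.InformationTheory.Entanglement.WStateWitness
import Mathlib.Analysis.Real.Sqrt
import Mathlib.Data.Nat.Choose.Central
import Mathlib.Algebra.BigOperators.Intervals
import HarnessLib

/-!
# The Dicke-state fidelity witness: `Tr(ρ|D_{N/2,N}⟩⟨D_{N/2,N}|) > ½·N/(N−1) ⟹` genuine `N`-partite entanglement

Topic `Literature/InformationTheory/Entanglement`, companion of `GHZFidelityWitness.lean` and
`WStateWitness.lean` (same register `Fin N → Bool`, same `tensorAcross`, `IsBiseparablePure`,
`IsBiseparable`, `vecState`, `excCount`).  Sources (held texts, read at the cited places):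

* G. Tóth, *Detection of multipartite entanglement in the vicinity of symmetric Dicke states*,
  J. Opt. Soc. Am. B 24, 275 (2007) = arXiv:quant-ph/0511237 [Toth2007DickeStates]: §1 eq. (1)
  “An `N`-qubit symmetric Dicke state with `m` excitations is defined as
  `|m,N⟩ := C(N,m)^{−1/2} Σ_k P_k(|1₁,1₂,…,1_m,0_{m+1},…,0_N⟩)`”; §2 “A mixed state is biseparable
  if it can be created by mixing biseparable pure states … we know that for biseparable states
  `ρ`, `Tr(ρ|Ψ⟩⟨Ψ|) ≤ C_Ψ`. Here … `C_Ψ` is the square of the maximal overlap of `|Ψ⟩` with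
  biseparable states … it turns out that `C_Ψ` equals the square of the maximum of the Schmidt
  coefficients of `|Ψ⟩` with respect to all bipartitions”; **Theorem 1**: “For biseparable quantum
  states `ρ`: **`Tr(ρ|N/2,N⟩⟨N/2,N|) ≤ ½·N/(N−1) =: C_{N/2,N}`**. This condition detects
  entanglement close to an `N`-qubit symmetric Dicke state with `N/2` excitations. Here `N` is
  assumed to be even. *Proof.* The Schmidt decomposition of `|m,N⟩` according to the partition
  `(1,2,…,N₁)(N₁+1,…,N)` is `|m,N⟩ = Σ_k λ_k |k,N₁⟩ ⊗ |m−k,N−N₁⟩`, where the Schmidt coefficients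
  are `λ_k = C(N,m)^{−1/2} C(N₁,k)^{1/2} C(N−N₁,m−k)^{1/2}` … Now we use that
  `C(N₁,k)·C(N−N₁,N/2−k) ≤ C(2,1)·C(N−2,N/2−1)`. The proof … can be found in the Appendix. Thus we
  find that the maximal Schmidt coefficient can be obtained for `N₁ = 2` and `k = 1`”; after the
  theorem: “`C_{N/2,N} ≈ 1/2` for large `N`”, and for
  `ϱ(p) = p_noise𝟙/2^N + (1 − p_noise)|N/2,N⟩⟨N/2,N|`: “Our criterion is very robust: It detects
  a state of the form … as true multipartite entangled if
  **`p_noise < ½·[(N−2)/((N−1)(1−2^{−N}))]`**”; **Appendix**: with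
  `g_k := C(N₁,k)·C(N−N₁,N/2−k)` (“Without loss of generality, we consider `N₁ ≤ N/2`”),
  “`g_{k−1}/g_k = k(N/2−N₁+k)/((N₁−k+1)(N/2−k+1))` … the integer value for which `g_k` is maximal is
  `k = N₁/2` for even `N₁` and `k = (N₁±1)/2` for odd `N₁`”, `h_{N₁} := g_{⌊N₁/2⌋}`, “for even
  `N₁`, `h_{N₁}/h_{N₁±1} ≥ 1` … `h_{N₁}/h_{N₁−2} = ((N₁−1)/N₁)·((N−N₁+2)/(N−N₁+1)) ≤ 1`. Hence we
  know that `h_{N₁}` is maximized by `N₁ = 2`”.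
* O. Gühne, G. Tóth, *Entanglement detection*, Phys. Rep. 474, 1 (2009) = arXiv:0811.2803
  [GuhneToth2009]: §3.4.2 eq. (55) (the symmetric Dicke state `|D_{k,N}⟩`, “an equal superposition
  of `k` excitations”; “`|D_{2,4}⟩ = (|0011⟩ + |0101⟩ + |0110⟩ + |1001⟩ + |1010⟩ + |1100⟩)/√6`”);
  §3.6.1 eqs. (70)–(71) (projector witnesses `α𝟙 − |ψ⟩⟨ψ|`); §3.6.2 eq. (75): “For some symmetric
  Dicke states, the maximal overlap can also be computed straightforwardly [213] … for the
  `|D_{N/2,N}⟩` state it is **`𝒲_{D_N} = ½·N/(N−1)·𝟙 − |D_{N/2,N}⟩⟨D_{N/2,N}|`**”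
  ([213] = Tóth 2007).

HONEST FRAMING (pub-qadeq lane — photonic / trapped-ion / superconducting ‘`N`-qubit Dicke state
prepared with fidelity `F`’ milestones, read against `C_{2,4} = 2/3`, `C_{3,6} = 3/5`, …):
instance-level adjudication of specific advantage claims; no claim about BQP vs BPP or the summit.
This file proves the criterion; how a reported fidelity estimates the prepared state's fidelity
(tomography, witnesses from few settings, error bars) is not addressed here.

## Contents (all proved, 0 named facts)

* Weight classes and Dicke vectors on any finite register `ι → Bool`: `wtClass ι m` (labels with
  `m` excitations), **`card_wtClass`** (`= C(|ι|, m)`), `dickeAmp`, **`dickeVec ι m = |D_{m,ι}⟩`**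
  (eq. (55) / (1)), `dickeVec_dotProduct` (`⟨D_m|ψ⟩ = C(|ι|,m)^{−1/2}·S_m(ψ)`), `dickeVec_norm`;
  class sums / masses `classSum m ψ = S_m(ψ) = Σ_{#x=m} ψ(x)`, `classMass`;
  **`normSq_classSum_le`** (Cauchy–Schwarz inside a class: `|S_m(ψ)|² ≤ C(|ι|,m)·Σ_{#x=m}|ψ(x)|²`),
  `sum_classMass_le` (the classes are disjoint), `classSum_dickeVec`.
* **`star_dickeVec_dotProduct_tensorAcross`** — the Schmidt decomposition of the proof of
  Theorem 1 across an ARBITRARY cut `A | Ā` of the register, in amplitude form: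
  `⟨D_{n,N}| a ⊗ b⟩ = C(N,n)^{−1/2} Σ_{j ≤ n} S_j(a)·S_{n−j}(b)`; **`normSq_sum_classSum_mul_le`** /
  **`normSq_dicke_overlap_le_of_bound`**: any bound `G` on the Schmidt weights
  `C(|A|, j)·C(N−|A|, n−j)` (`j ≤ n`) gives `|⟨D_{n,N}| a ⊗ b⟩|² ≤ (G/C(N,n))·‖a‖²‖b‖²` — “`C_Ψ`
  equals the square of the maximum of the Schmidt coefficients”, in the inequality direction that
  Theorem 1 uses (Cauchy–Schwarz within classes, then Bessel across them).
* Tóth's Appendix, mirrored step by step: `schmidtWeight n k j = C(k,j)·C(2n−k,n−j)` (`= g_j` for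
  the cut size `N₁ = k`), the cleared ratio identity `schmidtWeight_succ_mul`, monotonicity below /
  above the mode (`schmidtWeight_le_succ`, `schmidtWeight_succ_le`), **`schmidtWeight_le_mode`**
  (mode `⌊k/2⌋`), `schmidtWeight_odd_le_even` (`h_{2m+1} ≤ h_{2m}`), `schmidtWeight_even_step`
  (`h_{N₁} ≤ h_{N₁−2}` for even `N₁ ≤ N/2 + 1`), `schmidtWeight_even_le_two`,
  `schmidtWeight_one_le_two`, the symmetry `schmidtWeight_symm` (`N₁ ↔ N − N₁`), and the printed
  inequality **`choose_mul_choose_le_central`**: `C(k,j)·C(2n−k,n−j) ≤ C(2,1)·C(2n−2,n−1)` for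
  every proper cut `1 ≤ k ≤ 2n−1` and `j ≤ n`; `central_ratio` (`n·C(2n,n) = (2n−1)·2C(2n−2,n−1)`,
  i.e. `λ₁² = 2C(2n−2,n−1)/C(2n,n) = n/(2n−1)`), `two_mul_choose_div_choose`, `tothConst_eq`
  (`n/(2n−1) = ½·N/(N−1)` for `N = 2n`).
* **Theorem 1, pure states**: `normSq_dicke_overlap_le` (per cut, `N = 2n`, both sides non-empty:
  `|⟨D_{N/2,N}| a ⊗ b⟩|² ≤ (n/(2n−1))·‖a‖²‖b‖²`),
  **`normSq_dicke_overlap_le_of_isBiseparablePure`**, and sharpness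
  **`normSq_dicke_overlap_pair_tensor`**: on a two-qubit cut the biseparable product
  `|D_{1,2}⟩_A ⊗ |D_{N/2−1,N−2}⟩_Ā` has squared overlap exactly `n/(2n−1)` (“the maximal Schmidt
  coefficient can be obtained for `N₁ = 2` and `k = 1`”).
* **Theorem 1, mixed states**: `dickeFidelity n ρ = ⟨D_{n,N}|ρ|D_{n,N}⟩ = Tr(ρ|n,N⟩⟨n,N|)`,
  `dickeFidelity_le_trace` (cone form), **`dickeFidelity_le`** (`≤ n/(2n−1)`) and
  **`dickeFidelity_le_half_mul`** (`≤ ½·N/(N−1)`) on biseparable `ρ`;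
  **`not_isBiseparable_of_lt_dickeFidelity`** (the GME criterion); `dickeFidelity_dicke` (`= 1`),
  `not_isBiseparable_dicke` (`N = 2n ≥ 4`); the witness form (75): `dickeWitness`,
  `trState_dickeWitness`, **`guhneToth_dickeWitness`** (`Tr(ρ𝒲_{D_N}) ≥ 0` on biseparable `ρ`);
  `tothConst_four_six` (`C_{2,4} = 2/3`, `C_{3,6} = 3/5`), `half_lt_tothConst` (`C_{N/2,N} > ½`).
* White noise: `dickeWhiteNoise N n p = ϱ(p)`, `dickeFidelity_dickeWhiteNoise` (`= 1 − p + p/2^N`),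
  **`lt_dickeFidelity_dickeWhiteNoise_iff`** (detected iff `p < ½·(N−2)/((N−1)(1−2^{−N}))`, the
  printed threshold), `not_isBiseparable_dickeWhiteNoise`, `dickeWhiteNoise_threshold_four_six`
  (`N = 4`: `16/45`; `N = 6`: `128/315`), `dickeWhiteNoise_threshold_lt_half`.

NOT formalised: Dicke states with `m ≠ N/2` excitations as witnesses (Theorem 1 is printed for
`m = N/2`; the per-cut estimate `normSq_dicke_overlap_le_of_bound` is stated for every `m`), the
equality “`C_Ψ` equals …” as a maximum (we prove the upper bound and exhibit the optimiser), Tóth's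
§3 collective-observable criteria (see `SpinSqueezingCriterion.lean` for eq. (197) of the review),
the `N = 3, 4` genuine-entanglement criteria (200)–(201) of the review, statistics of the fidelity
estimate.

## Mathlib / tree search

No Dicke state in Mathlib or the tree (`lean search 'Dicke|dicke'`: only the “NOT formalised” line
of `WStateWitness.lean`; `WStateWitness.wVec` is the case `m = 1`).  Reused: `excCount`,
`excCount_eq_add` (`WStateWitness.lean`); `tensorAcross`, `tensorAcross_normSq`, `IsBiseparablePure`,
`IsBiseparable`, `vecState_vecMulVec`, `vecState_sum_smul_vecMulVec`, `trace_sum_smul_vecMulVec`,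
`trace_eq_one_of_isBiseparable` (`GHZFidelityWitness.lean`); Mathlib's `Finset.card_powersetCard`,
`Equiv.piEquivPiSubtypeProd`, `sq_sum_le_card_mul_sum_sq` and `Real.sum_sqrt_mul_sqrt_le`
(Cauchy–Schwarz), `Finset.sum_fiberwise_eq_sum_filter`, `Nat.choose_succ_right_eq`,
`Nat.add_one_mul_choose_eq`, `Nat.choose_symm_half`, `Nat.choose_le_middle`,
`Nat.succ_mul_centralBinom_succ`.
-/

namespace Literature.InformationTheory.Entanglement

namespace DickeWitness

open Matrix Complex Finset
open Literature.InformationTheory.Entanglement.Tsirelson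
open GHZWitness WWitness

variable {N : ℕ}

/-! ## Weight classes of basis labels and the symmetric Dicke vectors -/

section Generic

variable {ι : Type*} [Fintype ι]

/-- The support (set of excited qubits) of a basis label. [cite: GuhneToth2009, §3.4.2 eq. (55)] -/
def supp (x : ι → Bool) : Finset ι := Finset.univ.filter fun i => x i = true

/-- `#x = |supp x|`. [cite: GuhneToth2009, §3.4.2 eq. (55)] -/
theorem card_supp (x : ι → Bool) : (supp x).card = excCount x := rfl

/-- The amplitude `C(|ι|, m)^{−1/2}` of (55). [cite: GuhneToth2009, §3.4.2 eq. (55);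
Toth2007DickeStates, §1 eq. (1)] -/
noncomputable def dickeAmp (ι : Type*) [Fintype ι] (m : ℕ) : ℝ :=
  (Real.sqrt ((Fintype.card ι).choose m))⁻¹

/-- `dickeAmp ≥ 0`. [cite: GuhneToth2009, §3.4.2 eq. (55)] -/
theorem dickeAmp_nonneg (m : ℕ) : 0 ≤ dickeAmp ι m := by
  rw [dickeAmp]; positivity

/-- `C(|ι|,m)^{−1/2} · C(|ι|,m)^{−1/2} · C(|ι|,m) = 1` (`m ≤ |ι|`). [cite: GuhneToth2009, §3.4.2
eq. (55)] -/
theorem dickeAmp_mul_dickeAmp_mul_choose {m : ℕ} (hm : m ≤ Fintype.card ι) :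
    dickeAmp ι m * dickeAmp ι m * (Fintype.card ι).choose m = 1 := by
  have hpos : (0 : ℝ) < (Fintype.card ι).choose m := by exact_mod_cast Nat.choose_pos hm
  rw [dickeAmp, ← mul_inv, Real.mul_self_sqrt hpos.le, inv_mul_cancel₀ hpos.ne']

/-- `dickeAmp² = 1 / C(|ι|, m)`. [cite: GuhneToth2009, §3.4.2 eq. (55)] -/
theorem dickeAmp_mul_self (m : ℕ) :
    dickeAmp ι m * dickeAmp ι m = 1 / (Fintype.card ι).choose m := by
  have h0 : (0 : ℝ) ≤ (Fintype.card ι).choose m := Nat.cast_nonneg _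
  rw [dickeAmp, ← mul_inv, Real.mul_self_sqrt h0, one_div]

variable [DecidableEq ι]

/-- The weight class `{x : #x = m}`: basis labels of the register `ι → Bool` with exactly `m`
excitations (the terms of the Dicke state (55) / (1)). [cite: GuhneToth2009, §3.4.2 eq. (55);
Toth2007DickeStates, §1 eq. (1)] -/
def wtClass (ι : Type*) [Fintype ι] [DecidableEq ι] (m : ℕ) : Finset (ι → Bool) :=
  Finset.univ.filter fun x => excCount x = m

/-- Membership in a weight class. [cite: GuhneToth2009, §3.4.2 eq. (55)] -/
theorem mem_wtClass {m : ℕ} {x : ι → Bool} : x ∈ wtClass ι m ↔ excCount x = m := by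
  simp [wtClass]

/-- **`|{x : #x = m}| = C(|ι|, m)`**: labels with `m` excitations are the `m`-subsets of the qubits
(“the sum over all possible permutations”, normalisation `C(N,k)^{−1/2}` of (55)).
[cite: GuhneToth2009, §3.4.2 eq. (55); Toth2007DickeStates, §1 eq. (1)] -/
theorem card_wtClass (m : ℕ) : (wtClass ι m).card = (Fintype.card ι).choose m := by
  classical
  rw [← Finset.card_univ, ← Finset.card_powersetCard m (Finset.univ : Finset ι)]
  refine Finset.card_bij (fun x _ => supp x) ?_ ?_ ?_
  · intro x hx
    rw [Finset.mem_powersetCard]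
    exact ⟨Finset.subset_univ _, by rw [card_supp, mem_wtClass.1 hx]⟩
  · intro x _ y _ h
    funext i
    have hi := congrArg (i ∈ ·) h
    simp only [supp, Finset.mem_filter, Finset.mem_univ, true_and, eq_iff_iff] at hi
    exact Bool.eq_iff_iff.2 hi
  · intro s hs
    rw [Finset.mem_powersetCard] at hs
    refine ⟨fun i => decide (i ∈ s), ?_, ?_⟩
    · rw [mem_wtClass, ← card_supp, ← hs.2]
      congr 1
      ext i
      simp [supp]
    · ext i
      simp [supp]

/-- **The symmetric Dicke vector** `|D_{m,ι}⟩ = C(|ι|,m)^{−1/2} Σ_{#x = m} |x⟩` on the register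
`ι → Bool` — “an equal superposition of `k` excitations” (55); Tóth's `|m,N⟩` (1).
[cite: GuhneToth2009, §3.4.2 eq. (55); Toth2007DickeStates, §1 eq. (1)] -/
noncomputable def dickeVec (ι : Type*) [Fintype ι] [DecidableEq ι] (m : ℕ) : (ι → Bool) → ℂ :=
  fun x => if excCount x = m then (dickeAmp ι m : ℂ) else 0

/-- Unfolding `dickeVec`. [cite: GuhneToth2009, §3.4.2 eq. (55)] -/
theorem dickeVec_apply (m : ℕ) (x : ι → Bool) :
    dickeVec ι m x = if excCount x = m then (dickeAmp ι m : ℂ) else 0 := rfl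

/-- The Dicke vector has real amplitudes. [cite: GuhneToth2009, §3.4.2 eq. (55)] -/
@[simp] theorem star_dickeVec (m : ℕ) : star (dickeVec ι m) = dickeVec ι m := by
  ext x
  rw [Pi.star_apply, dickeVec_apply]
  split_ifs <;> simp [Complex.conj_ofReal]

/-- The class sum `S_m(ψ) = Σ_{#x = m} ψ(x)` of the weight-`m` amplitudes.
[cite: Toth2007DickeStates, §2 (proof of Theorem 1: the Schmidt decomposition of `|m,N⟩`)] -/
def classSum (m : ℕ) (ψ : (ι → Bool) → ℂ) : ℂ := ∑ x ∈ wtClass ι m, ψ x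

/-- The class mass `Σ_{#x = m} |ψ(x)|²` of the weight-`m` amplitudes.
[cite: Toth2007DickeStates, §2 (proof of Theorem 1)] -/
def classMass (m : ℕ) (ψ : (ι → Bool) → ℂ) : ℝ := ∑ x ∈ wtClass ι m, Complex.normSq (ψ x)

/-- Class masses are non-negative. [cite: Toth2007DickeStates, §2 (proof of Theorem 1)] -/
theorem classMass_nonneg (m : ℕ) (ψ : (ι → Bool) → ℂ) : 0 ≤ classMass m ψ :=
  Finset.sum_nonneg fun _ _ => Complex.normSq_nonneg _

/-- `⟨D_m|ψ⟩ = C(|ι|,m)^{−1/2} · S_m(ψ)`: only weight-`m` amplitudes are seen by the Dicke vector.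
[cite: GuhneToth2009, §3.4.2 eq. (55)] -/
theorem dickeVec_dotProduct (m : ℕ) (ψ : (ι → Bool) → ℂ) :
    dickeVec ι m ⬝ᵥ ψ = (dickeAmp ι m : ℂ) * classSum m ψ := by
  rw [dotProduct, classSum, wtClass, Finset.sum_filter, Finset.mul_sum]
  refine Finset.sum_congr rfl fun x _ => ?_
  rw [dickeVec_apply]
  split_ifs <;> simp

/-- `⟨D_m|D_m⟩ = 1` (`m ≤ |ι|`). [cite: GuhneToth2009, §3.4.2 eq. (55)] -/
theorem dickeVec_norm {m : ℕ} (hm : m ≤ Fintype.card ι) :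
    star (dickeVec ι m) ⬝ᵥ dickeVec ι m = 1 := by
  rw [star_dickeVec, dickeVec_dotProduct, classSum]
  have h : ∑ x ∈ wtClass ι m, dickeVec ι m x = ∑ _x ∈ wtClass ι m, (dickeAmp ι m : ℂ) :=
    Finset.sum_congr rfl fun x hx => by rw [dickeVec_apply, if_pos (mem_wtClass.1 hx)]
  rw [h, Finset.sum_const, card_wtClass, nsmul_eq_mul, mul_comm ((_ : ℕ) : ℂ), ← mul_assoc]
  exact_mod_cast dickeAmp_mul_dickeAmp_mul_choose hm

/-- **Cauchy–Schwarz on a weight class**: `|S_m(ψ)|² ≤ C(|ι|,m) · Σ_{#x = m}|ψ(x)|²` (the overlap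
with the normalised class vector `|D_m⟩` is at most the class mass).
[cite: Toth2007DickeStates, §2 (proof of Theorem 1)] -/
theorem normSq_classSum_le (m : ℕ) (ψ : (ι → Bool) → ℂ) :
    Complex.normSq (classSum m ψ) ≤ (Fintype.card ι).choose m * classMass m ψ := by
  rw [Complex.normSq_eq_norm_sq, classSum, classMass, ← card_wtClass]
  calc ‖∑ x ∈ wtClass ι m, ψ x‖ ^ 2 ≤ (∑ x ∈ wtClass ι m, ‖ψ x‖) ^ 2 := by
        gcongr; exact norm_sum_le _ _
    _ ≤ (wtClass ι m).card * ∑ x ∈ wtClass ι m, ‖ψ x‖ ^ 2 := sq_sum_le_card_mul_sum_sq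
    _ = (wtClass ι m).card * ∑ x ∈ wtClass ι m, Complex.normSq (ψ x) := by
        simp only [Complex.normSq_eq_norm_sq]

/-- The weight classes are disjoint: `Σ_{m ∈ s} Σ_{#x = m}|ψ(x)|² ≤ ‖ψ‖²` for any set `s` of
weights. [cite: Toth2007DickeStates, §2 (proof of Theorem 1)] -/
theorem sum_classMass_le (s : Finset ℕ) (ψ : (ι → Bool) → ℂ) :
    ∑ m ∈ s, classMass m ψ ≤ ∑ x, Complex.normSq (ψ x) := by
  simp only [classMass, wtClass]
  rw [Finset.sum_fiberwise_eq_sum_filter]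
  exact Finset.sum_le_sum_of_subset_of_nonneg (Finset.filter_subset _ _)
    fun _ _ _ => Complex.normSq_nonneg _

/-- `Re⟨ψ|ψ⟩ = Σ_x |ψ(x)|²`. [cite: GuhneToth2009, §3.6.1 eq. (70)] -/
theorem star_dotProduct_self_re' {κ : Type*} [Fintype κ] (ψ : κ → ℂ) :
    (star ψ ⬝ᵥ ψ).re = ∑ x, Complex.normSq (ψ x) := by
  rw [dotProduct, Complex.re_sum]
  refine Finset.sum_congr rfl fun x _ => ?_
  rw [Pi.star_apply, Complex.star_def, ← Complex.normSq_eq_conj_mul_self, Complex.ofReal_re]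

/-- The class sums of a Dicke vector: `S_j(D_m) = [j = m] · C(|ι|,m) · C(|ι|,m)^{−1/2}`.
[cite: GuhneToth2009, §3.4.2 eq. (55)] -/
theorem classSum_dickeVec (j m : ℕ) :
    classSum j (dickeVec ι m) =
      if j = m then ((Fintype.card ι).choose m : ℂ) * dickeAmp ι m else 0 := by
  rw [classSum]
  split_ifs with h
  · subst h
    have e : ∑ x ∈ wtClass ι j, dickeVec ι j x = ∑ _x ∈ wtClass ι j, (dickeAmp ι j : ℂ) :=
      Finset.sum_congr rfl fun x hx => by rw [dickeVec_apply, if_pos (mem_wtClass.1 hx)]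
    rw [e, Finset.sum_const, card_wtClass, nsmul_eq_mul]
  · refine Finset.sum_eq_zero fun x hx => ?_
    rw [dickeVec_apply, if_neg]
    rw [mem_wtClass.1 hx]; exact h

/-! ## The overlap estimate behind the Schmidt decomposition, for any bound on the binomial products -/

omit [DecidableEq ι] in
/-- Splitting the indicator of `#u + #v = n` over the weight `j` of `u`:
`[#u + #v = n]·ab = Σ_{j ≤ n} [#u = j]a · [#v = n−j]b`. [cite: Toth2007DickeStates, §2 (proof of
Theorem 1, the Schmidt decomposition of `|m,N⟩`)] -/
theorem ite_excCount_add_eq {V : Type*} [Fintype V] (n : ℕ) (u : ι → Bool) (v : V → Bool)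
    (a b : ℂ) :
    (if excCount u + excCount v = n then a * b else 0) =
      ∑ j ∈ Finset.range (n + 1),
        (if excCount u = j then a else 0) * (if excCount v = n - j then b else 0) := by
  have h : ∀ j ∈ Finset.range (n + 1),
      (if excCount u = j then a else 0) * (if excCount v = n - j then b else 0) =
        if excCount u = j then (if excCount v = n - j then a * b else 0) else 0 := by
    intro j _
    split_ifs <;> simp
  rw [Finset.sum_congr rfl h, Finset.sum_ite_eq]
  by_cases hu : excCount u ≤ n
  · rw [if_pos (Finset.mem_range.2 (Nat.lt_succ_of_le hu))]
    by_cases hv : excCount v = n - excCount u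
    · rw [if_pos hv, if_pos (by omega)]
    · rw [if_neg hv, if_neg (by omega)]
  · have hu' : excCount u ∉ Finset.range (n + 1) := by
      rw [Finset.mem_range]; omega
    rw [if_neg hu', if_neg (by omega)]

/-- **The overlap estimate.**  For two registers `U`, `V` and amplitudes `a`, `b`: if
`C(|U|, j)·C(|V|, n−j) ≤ G` for all `j ≤ n`, then
`|Σ_{j ≤ n} S_j(a) S_{n−j}(b)|² ≤ G · ‖a‖² ‖b‖²` — Cauchy–Schwarz inside each weight class
(`|S_j(a)|² ≤ C(|U|,j)·Σ_{#u=j}|a|²`), then across the classes (Bessel: the classes are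
disjoint).  This is “`C_Ψ` equals the square of the maximum of the Schmidt coefficients” applied to
the Schmidt decomposition of the Dicke state. [cite: Toth2007DickeStates, §2 (the bound
`Tr(ρ|Ψ⟩⟨Ψ|) ≤ C_Ψ`, the definition of `C_Ψ`, and the proof of Theorem 1: Schmidt decomposition and
coefficients `λ_k`)] -/
theorem normSq_sum_classSum_mul_le {V : Type*} [Fintype V] [DecidableEq V] (n G : ℕ)
    (a : (ι → Bool) → ℂ) (b : (V → Bool) → ℂ)
    (hG : ∀ j ∈ Finset.range (n + 1),
      (Fintype.card ι).choose j * (Fintype.card V).choose (n - j) ≤ G) :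
    Complex.normSq (∑ j ∈ Finset.range (n + 1), classSum j a * classSum (n - j) b) ≤
      G * ((∑ u, Complex.normSq (a u)) * (∑ v, Complex.normSq (b v))) := by
  set α : ℕ → ℝ := fun j => classMass j a with hα
  set β : ℕ → ℝ := fun j => classMass (n - j) b with hβ
  have hα0 : ∀ j, 0 ≤ α j := fun j => classMass_nonneg _ _
  have hβ0 : ∀ j, 0 ≤ β j := fun j => classMass_nonneg _ _
  -- termwise: `|S_j(a)||S_{n-j}(b)| ≤ √G · √α_j √β_j`
  have hterm : ∀ j ∈ Finset.range (n + 1),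
      ‖classSum j a * classSum (n - j) b‖ ≤ Real.sqrt G * (Real.sqrt (α j) * Real.sqrt (β j)) := by
    intro j hj
    rw [norm_mul]
    have ha : ‖classSum j a‖ ≤ Real.sqrt (((Fintype.card ι).choose j : ℝ) * α j) := by
      rw [← Real.sqrt_sq (norm_nonneg (classSum j a))]
      exact Real.sqrt_le_sqrt (by rw [← Complex.normSq_eq_norm_sq]; exact normSq_classSum_le j a)
    have hb : ‖classSum (n - j) b‖ ≤ Real.sqrt (((Fintype.card V).choose (n - j) : ℝ) * β j) := by
      rw [← Real.sqrt_sq (norm_nonneg (classSum (n - j) b))]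
      exact Real.sqrt_le_sqrt (by
        rw [← Complex.normSq_eq_norm_sq]; exact normSq_classSum_le (n - j) b)
    have hCD : Real.sqrt (((Fintype.card ι).choose j : ℝ) * ((Fintype.card V).choose (n - j) : ℝ))
        ≤ Real.sqrt G := Real.sqrt_le_sqrt (by exact_mod_cast hG j hj)
    calc ‖classSum j a‖ * ‖classSum (n - j) b‖
        ≤ Real.sqrt (((Fintype.card ι).choose j : ℝ) * α j) *
            Real.sqrt (((Fintype.card V).choose (n - j) : ℝ) * β j) :=
          mul_le_mul ha hb (norm_nonneg _) (Real.sqrt_nonneg _)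
      _ = Real.sqrt (((Fintype.card ι).choose j : ℝ) * ((Fintype.card V).choose (n - j) : ℝ)) *
            (Real.sqrt (α j) * Real.sqrt (β j)) := by
          rw [Real.sqrt_mul (Nat.cast_nonneg _), Real.sqrt_mul (Nat.cast_nonneg _),
            Real.sqrt_mul (Nat.cast_nonneg _)]
          ring
      _ ≤ Real.sqrt G * (Real.sqrt (α j) * Real.sqrt (β j)) :=
          mul_le_mul_of_nonneg_right hCD (by positivity)
  -- the reflected class masses of `b` are still disjoint classes
  have hβsum : ∑ j ∈ Finset.range (n + 1), β j ≤ ∑ v, Complex.normSq (b v) := by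
    have hr := Finset.sum_range_reflect (fun j => classMass j b) (n + 1)
    simp only [Nat.add_sub_cancel] at hr
    rw [hβ]
    simp only
    rw [hr]
    exact sum_classMass_le _ b
  have hαsum : ∑ j ∈ Finset.range (n + 1), α j ≤ ∑ u, Complex.normSq (a u) := sum_classMass_le _ a
  have hA0 : 0 ≤ ∑ u, Complex.normSq (a u) := Finset.sum_nonneg fun _ _ => Complex.normSq_nonneg _
  have hB0 : 0 ≤ ∑ v, Complex.normSq (b v) := Finset.sum_nonneg fun _ _ => Complex.normSq_nonneg _
  -- sum: triangle inequality, then Cauchy–Schwarz across the classes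
  have hsum : ‖∑ j ∈ Finset.range (n + 1), classSum j a * classSum (n - j) b‖ ≤
      Real.sqrt G * (Real.sqrt (∑ u, Complex.normSq (a u)) * Real.sqrt (∑ v, Complex.normSq (b v))) :=
    calc ‖∑ j ∈ Finset.range (n + 1), classSum j a * classSum (n - j) b‖
        ≤ ∑ j ∈ Finset.range (n + 1), ‖classSum j a * classSum (n - j) b‖ := norm_sum_le _ _
      _ ≤ ∑ j ∈ Finset.range (n + 1), Real.sqrt G * (Real.sqrt (α j) * Real.sqrt (β j)) :=
          Finset.sum_le_sum hterm
      _ = Real.sqrt G * ∑ j ∈ Finset.range (n + 1), Real.sqrt (α j) * Real.sqrt (β j) := by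
          rw [Finset.mul_sum]
      _ ≤ Real.sqrt G * (Real.sqrt (∑ j ∈ Finset.range (n + 1), α j) *
            Real.sqrt (∑ j ∈ Finset.range (n + 1), β j)) :=
          mul_le_mul_of_nonneg_left (Real.sum_sqrt_mul_sqrt_le _ hα0 hβ0) (Real.sqrt_nonneg _)
      _ ≤ Real.sqrt G * (Real.sqrt (∑ u, Complex.normSq (a u)) *
            Real.sqrt (∑ v, Complex.normSq (b v))) :=
          mul_le_mul_of_nonneg_left (mul_le_mul (Real.sqrt_le_sqrt hαsum) (Real.sqrt_le_sqrt hβsum)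
            (Real.sqrt_nonneg _) (Real.sqrt_nonneg _)) (Real.sqrt_nonneg _)
  have hG0 : (0 : ℝ) ≤ G := Nat.cast_nonneg _
  rw [Complex.normSq_eq_norm_sq]
  calc ‖∑ j ∈ Finset.range (n + 1), classSum j a * classSum (n - j) b‖ ^ 2
      ≤ (Real.sqrt G * (Real.sqrt (∑ u, Complex.normSq (a u)) *
          Real.sqrt (∑ v, Complex.normSq (b v)))) ^ 2 := by
        gcongr
    _ = G * ((∑ u, Complex.normSq (a u)) * (∑ v, Complex.normSq (b v))) := by
        rw [mul_pow, mul_pow, Real.sq_sqrt hG0, Real.sq_sqrt hA0, Real.sq_sqrt hB0]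

end Generic

/-! ## The reduction across a cut `A | Ā` (the Schmidt decomposition of the proof of Theorem 1) -/

section Cut

variable (A : Finset (Fin N))

/-- **The Schmidt form of a Dicke state across a cut** (the decomposition in the proof of
Theorem 1, amplitude version): for
every cut `A | Ā` and all `a`, `b`,
`⟨D_{n,N}| a ⊗ b⟩ = C(N,n)^{−1/2} · Σ_{j=0}^{n} S_j(a) · S_{n−j}(b)` — a weight-`n` label of the
register has `j` excitations in `A` and `n − j` in `Ā`. [cite: Toth2007DickeStates, §2 (proof of
Theorem 1: “`|m,N⟩ = Σ_k λ_k |k,N₁⟩ ⊗ |m−k,N−N₁⟩`”)] -/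
theorem star_dickeVec_dotProduct_tensorAcross (n : ℕ) (a : ({i // i ∈ A} → Bool) → ℂ)
    (b : ({i // i ∉ A} → Bool) → ℂ) :
    star (dickeVec (Fin N) n) ⬝ᵥ tensorAcross A a b =
      (dickeAmp (Fin N) n : ℂ) *
        ∑ j ∈ Finset.range (n + 1), classSum j a * classSum (n - j) b := by
  classical
  rw [star_dickeVec, dickeVec_dotProduct]
  congr 1
  rw [classSum, wtClass, Finset.sum_filter]
  let e := Equiv.piEquivPiSubtypeProd (fun i : Fin N => i ∈ A) (fun _ => Bool)
  have step : ∑ x : Fin N → Bool, (if excCount x = n then tensorAcross A a b x else 0) =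
      ∑ q : ({i // i ∈ A} → Bool) × ({i // i ∉ A} → Bool),
        (if excCount q.1 + excCount q.2 = n then a q.1 * b q.2 else 0) := by
    refine Fintype.sum_equiv e _ _ fun x => ?_
    rw [excCount_eq_add A x, tensorAcross_apply]
    rfl
  rw [step, Fintype.sum_prod_type]
  simp_rw [ite_excCount_add_eq n]
  calc ∑ u : {i // i ∈ A} → Bool, ∑ v : {i // i ∉ A} → Bool, ∑ j ∈ Finset.range (n + 1),
        (if excCount u = j then a u else 0) * (if excCount v = n - j then b v else 0)
      = ∑ u : {i // i ∈ A} → Bool, ∑ j ∈ Finset.range (n + 1), ∑ v : {i // i ∉ A} → Bool,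
        (if excCount u = j then a u else 0) * (if excCount v = n - j then b v else 0) :=
        Finset.sum_congr rfl fun u _ => Finset.sum_comm
    _ = ∑ j ∈ Finset.range (n + 1), ∑ u : {i // i ∈ A} → Bool, ∑ v : {i // i ∉ A} → Bool,
        (if excCount u = j then a u else 0) * (if excCount v = n - j then b v else 0) :=
        Finset.sum_comm
    _ = ∑ j ∈ Finset.range (n + 1), classSum j a * classSum (n - j) b := by
        refine Finset.sum_congr rfl fun j _ => ?_
        rw [← Finset.sum_mul_sum, classSum, classSum, wtClass, wtClass, Finset.sum_filter,
          Finset.sum_filter]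

variable {A}

/-- `|A|` as the cardinality of the subtype. [cite: Toth2007DickeStates, §2 (proof of Theorem 1)] -/
theorem card_in : Fintype.card {i // i ∈ A} = A.card := Fintype.card_coe A

/-- `|Ā| = N − |A|` as the cardinality of the subtype. [cite: Toth2007DickeStates, §2 (proof of
Theorem 1)] -/
theorem card_out : Fintype.card {i // i ∉ A} = N - A.card := by
  rw [Fintype.card_subtype_compl, Fintype.card_coe, Fintype.card_fin]

/-- **Per-cut overlap bound with any uniform bound `G` on the Schmidt weights**:
`C`-free form — if `C(|A|, j)·C(N−|A|, n−j) ≤ G` for `j ≤ n` then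
`|⟨D_{n,N}| a ⊗ b⟩|² ≤ (G / C(N,n)) · ‖a‖²‖b‖²` (the squared Schmidt coefficients of the proof of
Theorem 1 are `λ_k² = C(N₁,k)C(N−N₁,m−k)/C(N,m)`). [cite: Toth2007DickeStates, §2 (proof of Theorem 1,
the Schmidt coefficients `λ_k`)] -/
theorem normSq_dicke_overlap_le_of_bound (n G : ℕ) (a : ({i // i ∈ A} → Bool) → ℂ)
    (b : ({i // i ∉ A} → Bool) → ℂ)
    (hG : ∀ j ∈ Finset.range (n + 1), A.card.choose j * (N - A.card).choose (n - j) ≤ G) :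
    Complex.normSq (star (dickeVec (Fin N) n) ⬝ᵥ tensorAcross A a b) ≤
      (G : ℝ) / (N.choose n) * ((∑ u, Complex.normSq (a u)) * (∑ v, Complex.normSq (b v))) := by
  rw [star_dickeVec_dotProduct_tensorAcross, Complex.normSq_mul, Complex.normSq_ofReal,
    dickeAmp_mul_self, Fintype.card_fin]
  have h := normSq_sum_classSum_mul_le n G a b fun j hj => by
    rw [card_in, card_out]; exact hG j hj
  calc 1 / ((N.choose n : ℕ) : ℝ) *
        Complex.normSq (∑ j ∈ Finset.range (n + 1), classSum j a * classSum (n - j) b)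
      ≤ 1 / ((N.choose n : ℕ) : ℝ) *
        (G * ((∑ u, Complex.normSq (a u)) * (∑ v, Complex.normSq (b v)))) :=
        mul_le_mul_of_nonneg_left h (by positivity)
    _ = (G : ℝ) / (N.choose n) * ((∑ u, Complex.normSq (a u)) * (∑ v, Complex.normSq (b v))) := by
        ring

end Cut

/-! ## The binomial inequality of Tóth's Appendix:
`C(N₁,k)·C(N−N₁, N/2−k) ≤ C(2,1)·C(N−2, N/2−1)` -/

section Binomial

/-- The Schmidt weight `g(k, j) = C(k, j)·C(2n−k, n−j)` of `|n,2n⟩` across a cut of size `k`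
(`C(2n,n)·λ_j²` in the proof of Theorem 1; the `g_k` of the Appendix for the cut size `N₁ = k`).
[cite: Toth2007DickeStates, Appendix (definition of `g_k`)] -/
def schmidtWeight (n k j : ℕ) : ℕ := k.choose j * (2 * n - k).choose (n - j)

/-- The consecutive-ratio identity of the Appendix (eq. for `g_{k−1}/g_k`), cleared of
denominators: `g(k, j+1)·(j+1)(n−k+j+1) = g(k, j)·(k−j)(n−j)` (`k ≤ n`, `j+1 ≤ n`).
[cite: Toth2007DickeStates, Appendix (ratio of two consecutive `g_k`)] -/
theorem schmidtWeight_succ_mul {n k j : ℕ} (hk : k ≤ n) (hj : j + 1 ≤ n) :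
    schmidtWeight n k (j + 1) * ((j + 1) * (n - k + j + 1)) =
      schmidtWeight n k j * ((k - j) * (n - j)) := by
  have e1 : n - j - 1 + 1 = n - j := by omega
  have e2 : 2 * n - k - (n - j - 1) = n - k + j + 1 := by omega
  have e3 : n - (j + 1) = n - j - 1 := by omega
  have h2 : (2 * n - k).choose (n - j) * (n - j) = (2 * n - k).choose (n - j - 1) * (n - k + j + 1) := by
    have := Nat.choose_succ_right_eq (2 * n - k) (n - j - 1)
    rw [e1, e2] at this
    exact this
  unfold schmidtWeight
  rw [e3]
  calc k.choose (j + 1) * (2 * n - k).choose (n - j - 1) * ((j + 1) * (n - k + j + 1))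
      = (k.choose (j + 1) * (j + 1)) * ((2 * n - k).choose (n - j - 1) * (n - k + j + 1)) := by ring
    _ = (k.choose j * (k - j)) * ((2 * n - k).choose (n - j) * (n - j)) := by
        rw [Nat.choose_succ_right_eq, h2]
    _ = k.choose j * (2 * n - k).choose (n - j) * ((k - j) * (n - j)) := by ring

/-- Below the mode the weights increase: `g(k, j) ≤ g(k, j+1)` for `2j + 1 ≤ k` (“for `k < k_m` we
know that `g_k/g_{k−1} ≥ 1`”). [cite: Toth2007DickeStates, Appendix] -/
theorem schmidtWeight_le_succ {n k j : ℕ} (hk : k ≤ n) (h : 2 * j + 1 ≤ k) :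
    schmidtWeight n k j ≤ schmidtWeight n k (j + 1) := by
  have hj : j + 1 ≤ n := by omega
  have hid := schmidtWeight_succ_mul hk hj
  have hXY : (j + 1) * (n - k + j + 1) ≤ (k - j) * (n - j) :=
    Nat.mul_le_mul (by omega) (by omega)
  have hX : 0 < (k - j) * (n - j) := Nat.mul_pos (by omega) (by omega)
  have : schmidtWeight n k j * ((k - j) * (n - j)) ≤
      schmidtWeight n k (j + 1) * ((k - j) * (n - j)) := by
    rw [← hid]; exact Nat.mul_le_mul_left _ hXY
  exact Nat.le_of_mul_le_mul_right this hX

/-- Above the mode the weights decrease: `g(k, j+1) ≤ g(k, j)` for `k ≤ 2j + 1`, `j + 1 ≤ n`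
(“while for `k > k_m` we have `g_k/g_{k−1} ≤ 1`”). [cite: Toth2007DickeStates, Appendix] -/
theorem schmidtWeight_succ_le {n k j : ℕ} (hk : k ≤ n) (hj : j + 1 ≤ n) (h : k ≤ 2 * j + 1) :
    schmidtWeight n k (j + 1) ≤ schmidtWeight n k j := by
  have hid := schmidtWeight_succ_mul hk hj
  have hXY : (k - j) * (n - j) ≤ (j + 1) * (n - k + j + 1) :=
    Nat.mul_le_mul (by omega) (by omega)
  have hY : 0 < (j + 1) * (n - k + j + 1) := Nat.mul_pos (by omega) (by omega)
  have : schmidtWeight n k (j + 1) * ((j + 1) * (n - k + j + 1)) ≤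
      schmidtWeight n k j * ((j + 1) * (n - k + j + 1)) := by
    rw [hid]; exact Nat.mul_le_mul_left _ hXY
  exact Nat.le_of_mul_le_mul_right this hY

/-- The mode of `j ↦ g(k, j)` is `⌊k/2⌋`, ascending side (“the integer value for which `g_k` is
maximal is `k = N₁/2` for even `N₁` and `k = (N₁ ± 1)/2` for odd `N₁`”).
[cite: Toth2007DickeStates, Appendix] -/
theorem schmidtWeight_le_mode_of_le {n k : ℕ} (hk : k ≤ n) :
    ∀ d j : ℕ, j + d = k / 2 → schmidtWeight n k j ≤ schmidtWeight n k (k / 2) := by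
  intro d
  induction d with
  | zero => intro j hj; rw [Nat.add_zero] at hj; rw [hj]
  | succ d ih =>
      intro j hj
      have h1 : schmidtWeight n k j ≤ schmidtWeight n k (j + 1) :=
        schmidtWeight_le_succ hk (by omega)
      exact h1.trans (ih (j + 1) (by omega))

/-- The mode of `j ↦ g(k, j)` is `⌊k/2⌋`, descending side. [cite: Toth2007DickeStates, Appendix] -/
theorem schmidtWeight_le_mode_of_ge {n k : ℕ} (hk : k ≤ n) :
    ∀ d j : ℕ, j = k / 2 + d → j ≤ n → schmidtWeight n k j ≤ schmidtWeight n k (k / 2) := by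
  intro d
  induction d with
  | zero => intro j hj _; rw [hj, Nat.add_zero]
  | succ d ih =>
      intro j hj hjn
      have h1 : schmidtWeight n k (k / 2 + d + 1) ≤ schmidtWeight n k (k / 2 + d) :=
        schmidtWeight_succ_le hk (by omega) (by omega)
      rw [hj, ← Nat.add_assoc]
      exact h1.trans (ih (k / 2 + d) rfl (by omega))

/-- **Row maximum**: `g(k, j) ≤ g(k, ⌊k/2⌋)` for all `j ≤ n` (`k ≤ n`).
[cite: Toth2007DickeStates, Appendix (the maximum `h_{N₁}` of `g_k`)] -/
theorem schmidtWeight_le_mode {n k j : ℕ} (hk : k ≤ n) (hj : j ≤ n) :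
    schmidtWeight n k j ≤ schmidtWeight n k (k / 2) := by
  rcases le_or_gt j (k / 2) with h | h
  · exact schmidtWeight_le_mode_of_le hk (k / 2 - j) j (by omega)
  · exact schmidtWeight_le_mode_of_ge hk (j - k / 2) j (by omega) hj

/-- `2·C(2c+1, c+1) = C(2c+2, c+1)` (Pascal plus the symmetry `C(2c+1,c+1) = C(2c+1,c)`).
[cite: Toth2007DickeStates, Appendix] -/
theorem two_mul_choose_half (c : ℕ) : 2 * (2 * c + 1).choose (c + 1) = (2 * c + 2).choose (c + 1) := by
  rw [show 2 * c + 2 = 2 * c + 1 + 1 by ring, Nat.choose_succ_succ' (2 * c + 1) c,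
    Nat.choose_symm_half c]
  ring

/-- For even `N₁` the maximum is at least that of the odd neighbour: `g(2m+1, m) ≤ g(2m, m)`
(`2m + 1 ≤ n`) (“Hence `h_{N₁}` must be maximized for some even `N₁`”).
[cite: Toth2007DickeStates, Appendix (`h_{N₁}/h_{N₁±1} ≥ 1` for even `N₁`)] -/
theorem schmidtWeight_odd_le_even {n m : ℕ} (h : 2 * m + 1 ≤ n) :
    schmidtWeight n (2 * m + 1) m ≤ schmidtWeight n (2 * m) m := by
  obtain ⟨c, hc⟩ : ∃ c, n - m = c + 1 := ⟨n - m - 1, by omega⟩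
  have e1 : 2 * n - (2 * m + 1) = 2 * c + 1 := by omega
  have e2 : 2 * n - 2 * m = 2 * c + 2 := by omega
  have hid : schmidtWeight n (2 * m + 1) m * (2 * (m + 1)) =
      schmidtWeight n (2 * m) m * (2 * m + 1) := by
    unfold schmidtWeight
    rw [e1, e2, hc]
    have hA : (2 * m + 1) * (2 * m).choose m = (2 * m + 1).choose m * (m + 1) := by
      rw [Nat.add_one_mul_choose_eq (2 * m) m, Nat.choose_symm_half]
    calc (2 * m + 1).choose m * (2 * c + 1).choose (c + 1) * (2 * (m + 1))
        = ((2 * m + 1).choose m * (m + 1)) * (2 * (2 * c + 1).choose (c + 1)) := by ring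
      _ = ((2 * m + 1) * (2 * m).choose m) * (2 * c + 2).choose (c + 1) := by
          rw [← hA, two_mul_choose_half]
      _ = (2 * m).choose m * (2 * c + 2).choose (c + 1) * (2 * m + 1) := by ring
  have : schmidtWeight n (2 * m + 1) m * (2 * (m + 1)) ≤
      schmidtWeight n (2 * m) m * (2 * (m + 1)) := by
    rw [hid]; exact Nat.mul_le_mul_left _ (by omega)
  exact Nat.le_of_mul_le_mul_right this (by omega)

/-- `g(2m, m)` in terms of central binomial coefficients (`2m ≤ 2n`).
[cite: Toth2007DickeStates, Appendix (`h_{N₁}` for even `N₁`)] -/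
theorem schmidtWeight_even (n m : ℕ) (hm : m ≤ n) :
    schmidtWeight n (2 * m) m = Nat.centralBinom m * Nat.centralBinom (n - m) := by
  unfold schmidtWeight
  rw [Nat.centralBinom_eq_two_mul_choose, Nat.centralBinom_eq_two_mul_choose,
    show 2 * n - 2 * m = 2 * (n - m) by omega]

/-- The even-step monotonicity of the Appendix: `g(2p+2, p+1) ≤ g(2p, p)` for `2p + 1 ≤ n`
(“for even `N₁`, `h_{N₁}/h_{N₁−2} = ((N₁−1)/N₁)·((N−N₁+2)/(N−N₁+1)) ≤ 1`” — valid on the side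
`N₁ ≤ N/2 + 1`). [cite: Toth2007DickeStates, Appendix (`h_{N₁}/h_{N₁−2} ≤ 1`)] -/
theorem schmidtWeight_even_step {n p : ℕ} (h : 2 * p + 1 ≤ n) :
    schmidtWeight n (2 * p + 2) (p + 1) ≤ schmidtWeight n (2 * p) p := by
  obtain ⟨a, ha⟩ : ∃ a, n - p = a + 1 := ⟨n - p - 1, by omega⟩
  have hpa : p ≤ a := by omega
  rw [show 2 * p + 2 = 2 * (p + 1) by ring, schmidtWeight_even n (p + 1) (by omega),
    schmidtWeight_even n p (by omega), ha, show n - (p + 1) = a by omega]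
  -- `(p+1)·cb(p+1)·cb(a)·2(2a+1) = 2(2p+1)·cb(p)·(a+1)·cb(a+1)`
  have hid : Nat.centralBinom (p + 1) * Nat.centralBinom a * ((p + 1) * (2 * (2 * a + 1))) =
      Nat.centralBinom p * Nat.centralBinom (a + 1) * (2 * (2 * p + 1) * (a + 1)) := by
    have hp := Nat.succ_mul_centralBinom_succ p
    have hq := Nat.succ_mul_centralBinom_succ a
    calc Nat.centralBinom (p + 1) * Nat.centralBinom a * ((p + 1) * (2 * (2 * a + 1)))
        = ((p + 1) * Nat.centralBinom (p + 1)) * (2 * (2 * a + 1) * Nat.centralBinom a) := by ring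
      _ = (2 * (2 * p + 1) * Nat.centralBinom p) * ((a + 1) * Nat.centralBinom (a + 1)) := by
          rw [hp, hq]
      _ = Nat.centralBinom p * Nat.centralBinom (a + 1) * (2 * (2 * p + 1) * (a + 1)) := by ring
  have hXY : 2 * (2 * p + 1) * (a + 1) ≤ (p + 1) * (2 * (2 * a + 1)) := by nlinarith
  have hX : 0 < (p + 1) * (2 * (2 * a + 1)) := by positivity
  have : Nat.centralBinom (p + 1) * Nat.centralBinom a * ((p + 1) * (2 * (2 * a + 1))) ≤
      Nat.centralBinom p * Nat.centralBinom (a + 1) * ((p + 1) * (2 * (2 * a + 1))) := by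
    rw [hid]; exact Nat.mul_le_mul_left _ hXY
  exact Nat.le_of_mul_le_mul_right this hX

/-- Chaining the even steps: `g(2m, m) ≤ g(2, 1)` for `1 ≤ m`, `2m ≤ n` (“Hence we know that
`h_{N₁}` is maximized by `N₁ = 2`”). [cite: Toth2007DickeStates, Appendix] -/
theorem schmidtWeight_even_le_two {n : ℕ} :
    ∀ m : ℕ, 1 ≤ m → 2 * m ≤ n → schmidtWeight n (2 * m) m ≤ schmidtWeight n 2 1 := by
  intro m
  induction m with
  | zero => intro h; exact absurd h (by omega)
  | succ p ih =>
      intro _ h2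
      rcases Nat.eq_zero_or_pos p with hp | hp
      · subst hp; exact le_rfl
      · have step : schmidtWeight n (2 * p + 2) (p + 1) ≤ schmidtWeight n (2 * p) p :=
          schmidtWeight_even_step (by omega)
        rw [show 2 * (p + 1) = 2 * p + 2 by ring]
        exact step.trans (ih hp (by omega))

/-- The one-qubit cut: `g(1, 0) = C(2n−1, n) ≤ 2·C(2n−2, n−1) = g(2, 1)` (`1 ≤ n`).
[cite: Toth2007DickeStates, Appendix] -/
theorem schmidtWeight_one_le_two {n : ℕ} (hn : 1 ≤ n) :
    schmidtWeight n 1 0 ≤ schmidtWeight n 2 1 := by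
  obtain ⟨c, rfl⟩ : ∃ c, n = c + 1 := ⟨n - 1, by omega⟩
  unfold schmidtWeight
  rw [Nat.choose_zero_right, one_mul, Nat.sub_zero, show 2 * (c + 1) - 1 = 2 * c + 1 by omega,
    show 2 * (c + 1) - 2 = 2 * c by omega, show c + 1 - 1 = c by omega,
    show (2 : ℕ).choose 1 = 2 by rfl, Nat.choose_succ_succ' (2 * c) c]
  have h := Nat.choose_le_middle (c + 1) (2 * c)
  rw [show 2 * c / 2 = c by omega] at h
  omega

/-- **The binomial inequality of the Appendix**, for cuts `1 ≤ k ≤ n` (the side `N₁ ≤ N/2`):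
`C(k, j)·C(2n−k, n−j) ≤ 2·C(2n−2, n−1)` for all `j ≤ n`. [cite: Toth2007DickeStates, §2 (the
inequality in the proof of Theorem 1, “The proof … can be found in the Appendix”) and Appendix] -/
theorem schmidtWeight_le_of_le_half {n k j : ℕ} (hk1 : 1 ≤ k) (hk : k ≤ n) (hj : j ≤ n) :
    schmidtWeight n k j ≤ 2 * (2 * n - 2).choose (n - 1) := by
  have htwo : schmidtWeight n 2 1 = 2 * (2 * n - 2).choose (n - 1) := by
    unfold schmidtWeight; rfl
  rw [← htwo]
  refine (schmidtWeight_le_mode hk hj).trans ?_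
  obtain ⟨m, hm | hm⟩ := Nat.even_or_odd' k
  · -- even `k = 2m`, `m ≥ 1`
    subst hm
    rw [show 2 * m / 2 = m by omega]
    exact schmidtWeight_even_le_two m (by omega) hk
  · -- odd `k = 2m + 1`
    subst hm
    rw [show (2 * m + 1) / 2 = m by omega]
    rcases Nat.eq_zero_or_pos m with h0 | h0
    · subst h0
      exact schmidtWeight_one_le_two (by omega)
    · exact (schmidtWeight_odd_le_even hk).trans (schmidtWeight_even_le_two m h0 (by omega))

/-- The symmetry `N₁ ↔ N − N₁` of the cut (“Without loss of generality, we consider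
`N₁ ≤ N/2`”): `g(k, j) = g(2n−k, n−j)` for `k ≤ 2n`, `j ≤ n`. [cite: Toth2007DickeStates,
Appendix] -/
theorem schmidtWeight_symm {n k j : ℕ} (hk : k ≤ 2 * n) (hj : j ≤ n) :
    schmidtWeight n k j = schmidtWeight n (2 * n - k) (n - j) := by
  unfold schmidtWeight
  rw [show 2 * n - (2 * n - k) = k by omega, show n - (n - j) = j by omega, mul_comm]

/-- **Tóth's binomial inequality (Appendix), all proper cuts**: for `1 ≤ k ≤ 2n − 1` and
`j ≤ n`, `C(k, j)·C(2n−k, n−j) ≤ C(2,1)·C(2n−2, n−1)` — “the maximal Schmidt coefficient can be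
obtained for `N₁ = 2` and `k = 1`”. [cite: Toth2007DickeStates, §2 (proof of Theorem 1) and
Appendix] -/
theorem choose_mul_choose_le_central {n k j : ℕ} (hk1 : 1 ≤ k) (hk2 : k ≤ 2 * n - 1)
    (hj : j ≤ n) : k.choose j * (2 * n - k).choose (n - j) ≤ 2 * (2 * n - 2).choose (n - 1) := by
  change schmidtWeight n k j ≤ _
  rcases le_or_gt k n with h | h
  · exact schmidtWeight_le_of_le_half hk1 h hj
  · rw [schmidtWeight_symm (by omega) hj]
    exact schmidtWeight_le_of_le_half (by omega) (by omega) (by omega)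

/-- The value at the optimum: `n·C(2n, n) = (2n−1)·(2·C(2n−2, n−1))`, i.e.
`λ₁² = 2C(2n−2,n−1)/C(2n,n) = n/(2n−1) = ½·N/(N−1)` (“For `N₁ = 2` we obtain …”).
[cite: Toth2007DickeStates, §2 (proof of Theorem 1, last step)] -/
theorem central_ratio {n : ℕ} (hn : 1 ≤ n) :
    n * (2 * n).choose n = (2 * n - 1) * (2 * (2 * n - 2).choose (n - 1)) := by
  obtain ⟨c, rfl⟩ : ∃ c, n = c + 1 := ⟨n - 1, by omega⟩
  have h := Nat.succ_mul_centralBinom_succ c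
  rw [Nat.centralBinom_eq_two_mul_choose, Nat.centralBinom_eq_two_mul_choose] at h
  rw [show 2 * (c + 1) - 1 = 2 * c + 1 by omega, show 2 * (c + 1) - 2 = 2 * c by omega,
    show c + 1 - 1 = c by omega, h]
  ring

end Binomial

/-! ## Theorem 1: `|⟨D_{N/2,N}|φ⟩|² ≤ ½·N/(N−1)·⟨φ|φ⟩` on biseparable pure states, with equality
on the cut `(12)(3…N)` -/

section Witness

/-- The ratio at the optimum as a real number: `2·C(2n−2, n−1)/C(2n, n) = n/(2n−1)` (`n ≥ 1`).
[cite: Toth2007DickeStates, §2 (proof of Theorem 1, last step: “For `N₁ = 2` we obtain …”)] -/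
theorem two_mul_choose_div_choose {n : ℕ} (hn : 1 ≤ n) :
    ((2 * (2 * n - 2).choose (n - 1) : ℕ) : ℝ) / ((2 * n).choose n : ℕ) = n / (2 * n - 1) := by
  have hc := central_ratio hn
  have hC : (0 : ℝ) < (((2 * n).choose n : ℕ) : ℝ) := by exact_mod_cast Nat.choose_pos (by omega)
  have h1 : (1 : ℝ) ≤ n := by exact_mod_cast hn
  have h21 : (0 : ℝ) < 2 * n - 1 := by linarith
  rw [div_eq_div_iff hC.ne' h21.ne']
  have hc' : ((n * (2 * n).choose n : ℕ) : ℝ) =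
      (((2 * n - 1) * (2 * (2 * n - 2).choose (n - 1)) : ℕ) : ℝ) := by exact_mod_cast hc
  have e : ((2 * n - 1 : ℕ) : ℝ) = 2 * n - 1 := by
    rw [Nat.cast_sub (by omega)]; push_cast; ring
  rw [Nat.cast_mul, Nat.cast_mul, e] at hc'
  linarith

/-- The printed constant: `n/(2n−1) = ½·N/(N−1)` for `N = 2n`. [cite: Toth2007DickeStates, §2
Theorem 1 (“`≤ ½·N/(N−1) =: C_{N/2,N}`”); GuhneToth2009, §3.6.2 eq. (75)] -/
theorem tothConst_eq {N n : ℕ} (hN : N = 2 * n) :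
    (n : ℝ) / (2 * n - 1) = 1 / 2 * ((N : ℝ) / (N - 1)) := by
  subst hN
  push_cast
  rcases Nat.eq_zero_or_pos n with h0 | hpos
  · subst h0; simp
  · have h1 : (1 : ℝ) ≤ n := by exact_mod_cast hpos
    have h21 : (2 * (n : ℝ) - 1) ≠ 0 := by linarith
    field_simp

/-- **The Schmidt-coefficient bound, per cut** (Theorem 1, pure product states): for `N = 2n`,
every cut `A | Ā` with both sides non-empty and all `a`, `b`,
`|⟨D_{N/2,N}| a ⊗ b⟩|² ≤ (n/(2n−1))·‖a‖²·‖b‖²` — “the maximal Schmidt coefficient can be obtained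
for `N₁ = 2` and `k = 1`”. [cite: Toth2007DickeStates, §2 Theorem 1 and its proof; Appendix] -/
theorem normSq_dicke_overlap_le {N n : ℕ} (hN : N = 2 * n) {A : Finset (Fin N)} (hA : A.Nonempty)
    (hAc : Aᶜ.Nonempty) (a : ({i // i ∈ A} → Bool) → ℂ) (b : ({i // i ∉ A} → Bool) → ℂ) :
    Complex.normSq (star (dickeVec (Fin N) n) ⬝ᵥ tensorAcross A a b) ≤
      (n : ℝ) / (2 * n - 1) * ((∑ u, Complex.normSq (a u)) * (∑ v, Complex.normSq (b v))) := by
  subst hN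
  have hk1 : 1 ≤ A.card := hA.card_pos
  have hk2 : A.card ≤ 2 * n - 1 := by
    have h1 := hAc.card_pos
    rw [Finset.card_compl, Fintype.card_fin] at h1
    omega
  have hn : 1 ≤ n := by omega
  have h := normSq_dicke_overlap_le_of_bound n (2 * (2 * n - 2).choose (n - 1)) a b
    (fun j hj => choose_mul_choose_le_central hk1 hk2
      (by have := Finset.mem_range.1 hj; omega))
  rw [two_mul_choose_div_choose hn] at h
  exact h

/-- **Theorem 1 for biseparable pure states**: `|⟨D_{N/2,N}|ψ⟩|² ≤ (n/(2n−1))·⟨ψ|ψ⟩` (`N = 2n`),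
i.e. the maximal squared overlap `C_{N/2,N}` with biseparable states is at most `½·N/(N−1)`.
[cite: Toth2007DickeStates, §2 Theorem 1; GuhneToth2009, §3.6.2 eq. (75) with §3.6.1 eqs.
(70)–(71)] -/
theorem normSq_dicke_overlap_le_of_isBiseparablePure {N n : ℕ} (hN : N = 2 * n)
    {ψ : (Fin N → Bool) → ℂ} (hψ : IsBiseparablePure ψ) :
    Complex.normSq (star (dickeVec (Fin N) n) ⬝ᵥ ψ) ≤ (n : ℝ) / (2 * n - 1) * (star ψ ⬝ᵥ ψ).re := by
  obtain ⟨A, hA, hAc, a, b, rfl⟩ := hψ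
  rw [star_dotProduct_self_re', tensorAcross_normSq]
  exact normSq_dicke_overlap_le hN hA hAc a b

/-- **The bound is sharp** (“The bound … is sharp, that is, it is the lowest possible bound”;
“For `N₁ = 2` we obtain …”): on a two-qubit cut `A = {i, j}` the biseparable product
`|D_{1,A}⟩ ⊗ |D_{n−1,Ā}⟩ = ((|01⟩ + |10⟩)/√2)_A ⊗ |D_{N/2−1, N−2}⟩_Ā` has squared overlap with
`|D_{N/2,N}⟩` exactly `n/(2n−1) = ½·N/(N−1)`. [cite: Toth2007DickeStates, §2 (proof of Theorem 1,
“the maximal Schmidt coefficient can be obtained for `N₁ = 2` and `k = 1`”)] -/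
theorem normSq_dicke_overlap_pair_tensor {N n : ℕ} (hN : N = 2 * n) (hn : 1 ≤ n)
    {A : Finset (Fin N)} (hA : A.card = 2) :
    Complex.normSq (star (dickeVec (Fin N) n) ⬝ᵥ
        tensorAcross A (dickeVec {i // i ∈ A} 1) (dickeVec {i // i ∉ A} (n - 1))) =
      (n : ℝ) / (2 * n - 1) := by
  subst hN
  rw [star_dickeVec_dotProduct_tensorAcross]
  simp_rw [classSum_dickeVec]
  have hsum : ∑ j ∈ Finset.range (n + 1),
      ((if j = 1 then ((Fintype.card {i // i ∈ A}).choose 1 : ℂ) * dickeAmp {i // i ∈ A} 1 else 0) *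
        (if n - j = n - 1 then ((Fintype.card {i // i ∉ A}).choose (n - 1) : ℂ) *
          dickeAmp {i // i ∉ A} (n - 1) else 0)) =
      ((Fintype.card {i // i ∈ A}).choose 1 : ℂ) * dickeAmp {i // i ∈ A} 1 *
        (((Fintype.card {i // i ∉ A}).choose (n - 1) : ℂ) * dickeAmp {i // i ∉ A} (n - 1)) := by
    simp_rw [ite_mul, zero_mul]
    rw [Finset.sum_ite_eq' (Finset.range (n + 1)) 1, if_pos (Finset.mem_range.2 (by omega)),
      if_pos rfl]
  rw [hsum, card_in, card_out, hA, show (2 : ℕ).choose 1 = 2 by rfl]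
  -- everything is real
  have hreal : (dickeAmp (Fin (2 * n)) n : ℂ) * (((2 : ℕ) : ℂ) * (dickeAmp {i // i ∈ A} 1 : ℂ) *
      ((((2 * n - 2).choose (n - 1) : ℕ) : ℂ) * (dickeAmp {i // i ∉ A} (n - 1) : ℂ))) =
      ((dickeAmp (Fin (2 * n)) n * (2 * dickeAmp {i // i ∈ A} 1 *
        ((2 * n - 2).choose (n - 1) * dickeAmp {i // i ∉ A} (n - 1))) : ℝ) : ℂ) := by
    push_cast; ring
  rw [hreal, Complex.normSq_ofReal]
  -- the three squared amplitudes
  have h0 := dickeAmp_mul_self (ι := Fin (2 * n)) n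
  rw [Fintype.card_fin] at h0
  have h1 := dickeAmp_mul_self (ι := {i // i ∈ A}) 1
  rw [card_in, hA, show (2 : ℕ).choose 1 = 2 by rfl] at h1
  have h2 := dickeAmp_mul_self (ι := {i // i ∉ A}) (n - 1)
  rw [card_out, hA] at h2
  have hC' : (0 : ℝ) < (((2 * n - 2).choose (n - 1) : ℕ) : ℝ) := by
    exact_mod_cast Nat.choose_pos (by omega)
  rw [← two_mul_choose_div_choose hn]
  set x := dickeAmp (Fin (2 * n)) n
  set y := dickeAmp {i // i ∈ A} 1
  set z := dickeAmp {i // i ∉ A} (n - 1)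
  set C := (((2 * n).choose n : ℕ) : ℝ)
  set C' := (((2 * n - 2).choose (n - 1) : ℕ) : ℝ)
  have h2' : z * z * C' = 1 := by
    rw [h2, one_div, inv_mul_cancel₀ hC'.ne']
  calc x * (2 * y * (C' * z)) * (x * (2 * y * (C' * z)))
      = (x * x) * ((y * y) * 2) * (z * z * C') * (2 * C') := by ring
    _ = 1 / C * ((1 / (2 : ℕ)) * 2) * 1 * (2 * C') := by rw [h0, h1, h2']
    _ = ((2 * (2 * n - 2).choose (n - 1) : ℕ) : ℝ) / ((2 * n).choose n : ℕ) := by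
        push_cast; ring

/-! ## Mixed states: Theorem 1 / the witness (75) `𝒲 = ½·N/(N−1)·𝟙 − |D_{N/2,N}⟩⟨D_{N/2,N}|` -/

/-- The fidelity with the Dicke state: `Tr(ρ |n,N⟩⟨n,N|) = ⟨D_{n,N}|ρ|D_{n,N}⟩`.
[cite: Toth2007DickeStates, §2 Theorem 1 (“`Tr(ρ|N/2,N⟩⟨N/2,N|)`”)] -/
noncomputable def dickeFidelity (n : ℕ) (ρ : Matrix (Fin N → Bool) (Fin N → Bool) ℂ) : ℝ :=
  vecState (dickeVec (Fin N) n) ρ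

/-- Unfolding: `F = Re⟨D|ρ|D⟩`. [cite: Toth2007DickeStates, §2 Theorem 1] -/
theorem dickeFidelity_eq (n : ℕ) (ρ : Matrix (Fin N → Bool) (Fin N → Bool) ℂ) :
    dickeFidelity n ρ = (star (dickeVec (Fin N) n) ⬝ᵥ (ρ *ᵥ dickeVec (Fin N) n)).re := rfl

/-- **Cone form of Theorem 1.**  For `ρ = Σ p_i |ψ_i⟩⟨ψ_i|` with `p_i ≥ 0` and biseparable `ψ_i`
(“A mixed state is biseparable if it can be created by mixing biseparable pure states”):
`Tr(ρ |N/2,N⟩⟨N/2,N|) ≤ (n/(2n−1))·Tr ρ` (`N = 2n`). [cite: Toth2007DickeStates, §2 Theorem 1] -/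
theorem dickeFidelity_le_trace {N n : ℕ} (hN : N = 2 * n) {ι : Type*} [Fintype ι] {p : ι → ℝ}
    (hp : ∀ i, 0 ≤ p i) {ψ : ι → (Fin N → Bool) → ℂ} (hψ : ∀ i, IsBiseparablePure (ψ i)) :
    dickeFidelity n (∑ i, (p i : ℂ) • vecMulVec (ψ i) (star (ψ i))) ≤
      (n : ℝ) / (2 * n - 1) * (∑ i, (p i : ℂ) • vecMulVec (ψ i) (star (ψ i))).trace.re := by
  rw [dickeFidelity, vecState_sum_smul_vecMulVec, trace_sum_smul_vecMulVec, Complex.re_sum,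
    Finset.mul_sum]
  refine Finset.sum_le_sum fun i _ => ?_
  rw [Complex.re_ofReal_mul, ← mul_assoc, mul_comm ((n : ℝ) / (2 * n - 1)) (p i), mul_assoc]
  exact mul_le_mul_of_nonneg_left (normSq_dicke_overlap_le_of_isBiseparablePure hN (hψ i)) (hp i)

/-- **Theorem 1 (Tóth 2007)**: for every biseparable `N`-qubit state `ρ` (`N = 2n` even),
`Tr(ρ |N/2,N⟩⟨N/2,N|) ≤ n/(2n−1)`. [cite: Toth2007DickeStates, §2 Theorem 1] -/
theorem dickeFidelity_le {N n : ℕ} (hN : N = 2 * n) {ρ : Matrix (Fin N → Bool) (Fin N → Bool) ℂ}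
    (hρ : IsBiseparable ρ) : dickeFidelity n ρ ≤ (n : ℝ) / (2 * n - 1) := by
  have htr := trace_eq_one_of_isBiseparable hρ
  obtain ⟨ι, _, p, ψ, hp, -, -, hψ, rfl⟩ := hρ
  have h := dickeFidelity_le_trace hN hp hψ
  rwa [htr, Complex.one_re, mul_one] at h

/-- **Theorem 1 with the printed constant**: `Tr(ρ |N/2,N⟩⟨N/2,N|) ≤ ½·N/(N−1) =: C_{N/2,N}` for
every biseparable `ρ` (`N` even). [cite: Toth2007DickeStates, §2 Theorem 1; GuhneToth2009, §3.6.2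
eq. (75)] -/
theorem dickeFidelity_le_half_mul {N n : ℕ} (hN : N = 2 * n)
    {ρ : Matrix (Fin N → Bool) (Fin N → Bool) ℂ} (hρ : IsBiseparable ρ) :
    dickeFidelity n ρ ≤ 1 / 2 * ((N : ℝ) / (N - 1)) := by
  rw [← tothConst_eq hN]; exact dickeFidelity_le hN hρ

/-- **The GME criterion** (“Any state `ρ` violating [the bound `Tr(ρ|Ψ⟩⟨Ψ|) ≤ C_Ψ`] is necessarily
genuine multipartite entangled”): `Tr(ρ |N/2,N⟩⟨N/2,N|) > ½·N/(N−1) ⟹ ρ` is not biseparable.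
[cite: Toth2007DickeStates, §2 Theorem 1; GuhneToth2009, §3.6.2 eq. (75)] -/
theorem not_isBiseparable_of_lt_dickeFidelity {N n : ℕ} (hN : N = 2 * n)
    {ρ : Matrix (Fin N → Bool) (Fin N → Bool) ℂ} (h : 1 / 2 * ((N : ℝ) / (N - 1)) < dickeFidelity n ρ) :
    ¬ IsBiseparable ρ :=
  fun hρ => absurd h (not_lt.2 (dickeFidelity_le_half_mul hN hρ))

/-- The criterion is not vacuous: `Tr(|n,N⟩⟨n,N| · |n,N⟩⟨n,N|) = 1` (`n ≤ N`).
[cite: Toth2007DickeStates, §2 (fidelity-based criteria: “the state prepared … is close to `|Ψ⟩`”)] -/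
theorem dickeFidelity_dicke {n : ℕ} (hn : n ≤ N) :
    dickeFidelity n (vecMulVec (dickeVec (Fin N) n) (star (dickeVec (Fin N) n))) = 1 := by
  rw [dickeFidelity, vecState_vecMulVec, dickeVec_norm (by rwa [Fintype.card_fin]), map_one]

/-- `½·N/(N−1) < 1` exactly when `N ≥ 3`; so for `N = 2n ≥ 4` the Dicke state `|N/2,N⟩` itself is
detected: it is genuinely `N`-partite entangled. [cite: Toth2007DickeStates, §2 Theorem 1
(“This condition detects entanglement close to an `N`-qubit symmetric Dicke state”)] -/
theorem not_isBiseparable_dicke {N n : ℕ} (hN : N = 2 * n) (hn : 2 ≤ n) :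
    ¬ IsBiseparable (vecMulVec (dickeVec (Fin N) n) (star (dickeVec (Fin N) n))) := by
  refine not_isBiseparable_of_lt_dickeFidelity hN ?_
  rw [dickeFidelity_dicke (by omega), ← tothConst_eq hN]
  have h1 : (2 : ℝ) ≤ n := by exact_mod_cast hn
  have hpos : (0 : ℝ) < 2 * n - 1 := by linarith
  rw [div_lt_one hpos]
  linarith

/-- The witness operator of eq. (75): `𝒲_{D_N} = ½·N/(N−1)·𝟙 − |D_{N/2,N}⟩⟨D_{N/2,N}|`.
[cite: GuhneToth2009, §3.6.2 eq. (75)] -/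
noncomputable def dickeWitness (N n : ℕ) : Matrix (Fin N → Bool) (Fin N → Bool) ℂ :=
  ((1 : ℝ) / 2 * ((N : ℝ) / (N - 1))) • (1 : Matrix (Fin N → Bool) (Fin N → Bool) ℂ) -
    vecMulVec (dickeVec (Fin N) n) (star (dickeVec (Fin N) n))

/-- `Tr(ρ 𝒲_{D_N}) = ½·N/(N−1)·Re Tr ρ − Tr(ρ|D⟩⟨D|)`. [cite: GuhneToth2009, §3.6.2 eq. (75) with
§3.6.1 eq. (70)] -/
theorem trState_dickeWitness (n : ℕ) (ρ : Matrix (Fin N → Bool) (Fin N → Bool) ℂ) :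
    trState ρ (dickeWitness N n) = 1 / 2 * ((N : ℝ) / (N - 1)) * ρ.trace.re - dickeFidelity n ρ := by
  rw [dickeWitness, map_sub, map_smul, smul_eq_mul, trState_apply, Matrix.mul_one, trState_apply,
    Matrix.mul_vecMulVec, trace_vecMulVec, dotProduct_comm, dickeFidelity_eq]

/-- **Eq. (75) as printed**: `𝒲_{D_N}` is an entanglement witness for genuine `N`-partite
entanglement — `Tr(ρ 𝒲_{D_N}) ≥ 0` for every biseparable `ρ` (`N` even).
[cite: GuhneToth2009, §3.6.2 eq. (75); Toth2007DickeStates, §2 Theorem 1] -/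
theorem guhneToth_dickeWitness {N n : ℕ} (hN : N = 2 * n)
    {ρ : Matrix (Fin N → Bool) (Fin N → Bool) ℂ} (hρ : IsBiseparable ρ) :
    0 ≤ trState ρ (dickeWitness N n) := by
  rw [trState_dickeWitness, trace_eq_one_of_isBiseparable hρ, Complex.one_re, mul_one]
  have h := dickeFidelity_le_half_mul hN hρ
  linarith

/-- The register's numbers: `C_{2,4} = 2/3` (four qubits, `|D_4^{(2)}⟩`) and `C_{3,6} = 3/5` (six
qubits, `|D_6^{(3)}⟩`). [cite: Toth2007DickeStates, §2 Theorem 1 (`C_{N/2,N} = ½·N/(N−1)`)] -/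
theorem tothConst_four_six :
    (1 / 2 * ((4 : ℝ) / (4 - 1)) = 2 / 3) ∧ (1 / 2 * ((6 : ℝ) / (6 - 1)) = 3 / 5) := by
  constructor <;> norm_num

/-- “Thus we find that `C_{N/2,N} ≈ 1/2` for large `N`”: the constant always exceeds `½`
(`N ≥ 2`; the limit is not formalised). [cite: Toth2007DickeStates, §2 (after Theorem 1)] -/
theorem half_lt_tothConst {N : ℕ} (hN : 2 ≤ N) : (1 : ℝ) / 2 < 1 / 2 * ((N : ℝ) / (N - 1)) := by
  have h2 : (2 : ℝ) ≤ N := by exact_mod_cast hN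
  have hpos : (0 : ℝ) < N - 1 := by linarith
  have : (1 : ℝ) < N / (N - 1) := by rw [lt_div_iff₀ hpos]; linarith
  linarith

/-! ## Robustness to white noise: `p_noise < ½·(N−2)/((N−1)(1−2^{−N}))` -/

/-- The Dicke state mixed with white noise,
`ϱ(p) = p_noise·𝟙/2^N + (1 − p_noise)|N/2,N⟩⟨N/2,N|`. [cite: Toth2007DickeStates, §2 (the state
`ϱ(p)` after Theorem 1)] -/
noncomputable def dickeWhiteNoise (N n : ℕ) (p : ℝ) : Matrix (Fin N → Bool) (Fin N → Bool) ℂ :=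
  (1 - p) • vecMulVec (dickeVec (Fin N) n) (star (dickeVec (Fin N) n)) +
    (p / 2 ^ N) • (1 : Matrix (Fin N → Bool) (Fin N → Bool) ℂ)

/-- `Tr(ϱ(p)|D⟩⟨D|) = (1 − p) + p/2^N` (`n ≤ N`). [cite: Toth2007DickeStates, §2 (white-noise
robustness of Theorem 1)] -/
theorem dickeFidelity_dickeWhiteNoise {n : ℕ} (hn : n ≤ N) (p : ℝ) :
    dickeFidelity n (dickeWhiteNoise N n p) = (1 - p) + p / 2 ^ N := by
  have hnorm : star (dickeVec (Fin N) n) ⬝ᵥ dickeVec (Fin N) n = 1 :=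
    dickeVec_norm (by rwa [Fintype.card_fin])
  have h1 : vecState (dickeVec (Fin N) n) (1 : Matrix (Fin N → Bool) (Fin N → Bool) ℂ) = 1 := by
    rw [vecState_apply, one_mulVec, hnorm, Complex.one_re]
  rw [dickeFidelity, dickeWhiteNoise, map_add, map_smul, map_smul, smul_eq_mul, smul_eq_mul, h1,
    mul_one, ← dickeFidelity, dickeFidelity_dicke hn, mul_one]

/-- **“Our criterion is very robust”**: Theorem 1 detects `ϱ(p)` as genuinely multipartite
entangled exactly for `p_noise < ½·[(N−2)/((N−1)(1−2^{−N}))]` (`N = 2n ≥ 2`).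
[cite: Toth2007DickeStates, §2 (the bound on `p_noise` after Theorem 1)] -/
theorem lt_dickeFidelity_dickeWhiteNoise_iff {N n : ℕ} (hN : N = 2 * n) (hn : 1 ≤ n) (p : ℝ) :
    1 / 2 * ((N : ℝ) / (N - 1)) < dickeFidelity n (dickeWhiteNoise N n p) ↔
      p < 1 / 2 * (((N : ℝ) - 2) / ((N - 1) * (1 - 1 / 2 ^ N))) := by
  rw [dickeFidelity_dickeWhiteNoise (by omega)]
  have hN2' : 2 ≤ N := by omega
  have hN2 : (2 : ℝ) ≤ N := by exact_mod_cast hN2'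
  have hNpos : (0 : ℝ) < N - 1 := by linarith
  have h2N : (1 : ℝ) < 2 ^ N := by
    have : N ≠ 0 := by omega
    exact_mod_cast Nat.one_lt_two_pow this
  have hqpos : (0 : ℝ) < 1 - 1 / 2 ^ N := by
    rw [sub_pos, div_lt_one (by positivity)]; exact h2N
  have e1 : 1 - p + p / 2 ^ N = 1 - p * (1 - 1 / 2 ^ N) := by ring
  have e2 : (1 : ℝ) / 2 * (((N : ℝ) - 2) / ((N - 1) * (1 - 1 / 2 ^ N))) =
      ((N : ℝ) - 2) / (2 * ((N - 1) * (1 - 1 / 2 ^ N))) := by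
    rw [div_mul_div_comm, one_mul]
  have e3 : (1 : ℝ) / 2 * ((N : ℝ) / (N - 1)) = (N : ℝ) / (2 * (N - 1)) := by
    rw [div_mul_div_comm, one_mul]
  have hd2 : (0 : ℝ) < 2 * ((N - 1) * (1 - 1 / 2 ^ N)) := by positivity
  have hd3 : (0 : ℝ) < 2 * ((N : ℝ) - 1) := by positivity
  rw [e1, e2, e3, lt_div_iff₀ hd2, div_lt_iff₀ hd3]
  set q : ℝ := 1 - 1 / 2 ^ N
  constructor
  · intro h; linarith
  · intro h; linarith

/-- Hence `ϱ(p)` is genuinely `N`-partite entangled for every `p_noise` below Tóth's threshold.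
[cite: Toth2007DickeStates, §2 (white-noise robustness of Theorem 1)] -/
theorem not_isBiseparable_dickeWhiteNoise {N n : ℕ} (hN : N = 2 * n) (hn : 1 ≤ n) {p : ℝ}
    (hp : p < 1 / 2 * (((N : ℝ) - 2) / ((N - 1) * (1 - 1 / 2 ^ N)))) :
    ¬ IsBiseparable (dickeWhiteNoise N n p) :=
  not_isBiseparable_of_lt_dickeFidelity hN ((lt_dickeFidelity_dickeWhiteNoise_iff hN hn p).2 hp)

/-- The thresholds for the register's cases: `N = 4`: `16/45 ≈ 0.36`; `N = 6`: `128/315 ≈ 0.41`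
(“For large `N` we have `p_noise ≤ 1/2`”). [cite: Toth2007DickeStates, §2 (the bound on
`p_noise`)] -/
theorem dickeWhiteNoise_threshold_four_six :
    (1 / 2 * (((4 : ℝ) - 2) / ((4 - 1) * (1 - 1 / 2 ^ 4))) = 16 / 45) ∧
      (1 / 2 * (((6 : ℝ) - 2) / ((6 - 1) * (1 - 1 / 2 ^ 6))) = 128 / 315) := by
  constructor <;> norm_num

/-- The white-noise threshold is always below `½` (`N ≥ 2`): `½·(N−2)/((N−1)(1−2^{−N})) < ½`.
[cite: Toth2007DickeStates, §2 (“For large `N` we have `p_noise ≤ 1/2`”)] -/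
theorem dickeWhiteNoise_threshold_lt_half {N : ℕ} (hN : 2 ≤ N) :
    1 / 2 * (((N : ℝ) - 2) / ((N - 1) * (1 - 1 / 2 ^ N))) < 1 / 2 := by
  have h2 : (2 : ℝ) ≤ N := by exact_mod_cast hN
  have h2N : (4 : ℝ) ≤ 2 ^ N := by
    have : (2:ℝ) ^ 2 ≤ 2 ^ N := pow_le_pow_right₀ (by norm_num) hN
    norm_num at this; exact this
  have hq : (0 : ℝ) < 1 - 1 / 2 ^ N := by
    rw [sub_pos, div_lt_one (by positivity)]; linarith
  have hden : (0 : ℝ) < (N - 1) * (1 - 1 / 2 ^ N) := mul_pos (by linarith) hq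
  have key : ((N : ℝ) - 2) / ((N - 1) * (1 - 1 / 2 ^ N)) < 1 := by
    rw [div_lt_one hden]
    -- `N − 2 < (N−1)(1 − 2^{−N})` iff `(N−1)/2^N < 1`
    have h3 : ((N : ℝ) - 1) / 2 ^ N < 1 := by
      rw [div_lt_one (by positivity)]
      have : (N : ℝ) < 2 ^ N := by exact_mod_cast Nat.lt_two_pow_self
      linarith
    have e : ((N : ℝ) - 1) * (1 - 1 / 2 ^ N) = (N - 1) - (N - 1) / 2 ^ N := by ring
    rw [e]; linarith
  linarith

end Witness

end DickeWitness

end Literature.InformationTheory.Entanglement
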